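import Literature.MathematicalPhysics.KineticTheory.TaggedSphereCollisionFrequency
import Mathlib.MeasureTheory.Constructions.HaarToSphere
import HarnessLib

/-!
# Schur bounds for the truncated gain forms of the hard-sphere linear Boltzmann operator
(towards BGSR Lemma 6.1: Bodineau–Gallagher–Saint-Raymond, Invent. Math. 203 (2016),
arXiv:1305.3397v2 §6.1.2, after Hilbert 1912 and Grad; CIP 1994 §7.2)

BGSR's Lemma 6.1 asserts that `L = a_β(v) Id - K` is Fredholm on `L²(ℝ^d, a_β M_β dv)`, i.e.
that `T := a_β⁻¹ K` is a compact operator on that Hilbert space. The compactness proof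
(`TaggedSphereGainCompact`) splits the Carleman kernel `k_β(v, u)` of `K`
(`TaggedSphereCarleman`) with cut-off functions `χ(v, u)` into a regular part and small
remainders; this file provides the real-analysis estimates on the corresponding *truncated gain
forms* `Q_χ(g, h) = ∫∫ χ(v, u) M_β(v) k_β(v, u) g(v + u) h(v) du dv` for `g, h ∈ L²(a_β M_β)`:

* `truncForm`, its bilinearity, additivity in `χ`, invariance under a.e. modification of
  `g, h`, and `truncForm_one : Q_1 = carlemanForm`.
* **The weighted Schur test** `sq_truncForm_le`:
  `Q_χ(g, h)² ≤ (ρ' ‖g‖²_{aM}) (ρ ‖h‖²_{aM})` whenever the *row integrals*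
  `∫ χ(v, u) G_β(u) / √(a_β(v) a_β(v + u)) du` are `≤ ρ` for all `v` (`RowBound χ ρ`) and the same
  holds with `ρ'` for the reflected cut-off `χ~(v, u) = χ(v + u, -u)`; here
  `G_β(u) = (2π/β)^{-1/2} |u|^{2-d} e^{-β|u|²/8}` (`gradRadial`) is the radial factor of Grad's
  bound `M_β(v) k_β(v, u) ≤ G_β(u) √(M_β(v) M_β(v + u))` (`maxwellianBeta_mul_carlemanKernel_le`).
  The proof is Cauchy–Schwarz with the weight `√(a_β M_β(v + u) / a_β M_β(v))`, Tonelli, and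
  detailed balance `M_β(v) k_β(v, u) = M_β(v + u) k_β(v + u, -u)` for the `g`-side.
* Row bounds for the three cut-offs used downstream: `rowBound_one` (`ρ = I_β / a₀`,
  `I_β = ∫ G_β`), `rowBound_of_le_indicator_ball` (small `|u|`: `ρ = a₀⁻¹ ∫_{|u|<δ} G_β`) and
  `rowBound_indicator_norm_gt` (large `|v|`: `ρ = I_β / √(a₀ c R)`, using `a_β(v) ≥ c |v|` from
  `TaggedSphereCollisionFrequency`), with `∫_{|u|<δ} G_β → 0` (`tendsto_setIntegral_gradRadial`).

## References

* T. Bodineau, I. Gallagher, L. Saint-Raymond, *The Brownian motion as the limit of a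
  deterministic system of hard-spheres*, Invent. Math. 203 (2016) 493–553 = arXiv:1305.3397v2,
  §6.1.2, Lemma 6.1.
* C. Cercignani, R. Illner, M. Pulvirenti, *The Mathematical Theory of Dilute Gases*, Springer
  (1994), §7.2: (2.16)–(2.17) (Grad's kernel estimate), Thms 7.2.2–7.2.4 (`K ∈ B(L²) ∩ C(L²)` by
  truncation `χ_R K` and closedness of the compact operators), pp. 196–198.
-/

open MeasureTheory Metric Set Filter Topology ProbabilityTheory
open scoped InnerProductSpace ENNReal NNReal

noncomputable section

namespace Literature.MathematicalPhysics.KineticTheory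

open Literature.Analysis.FunctionSpaces (maxwellianBeta maxwellianBeta_pos)
open TaggedSphereDiffusion (collisionFrequency)

variable {d : Type*} [Fintype d] {β : ℝ}

/-! ## Grad's radial majorant -/

/-- The radial factor of Grad's bound on the joint kernel:
`G_β(u) = (2π/β)^{-1/2} |u|^{2-d} e^{-β|u|²/8}`, so that
`M_β(v) k_β(v, u) ≤ G_β(u) √(M_β(v) M_β(v + u))` (`maxwellianBeta_mul_carlemanKernel_le`); the
`d`-dimensional, linear-operator analogue of the hard-sphere kernel estimate CIP (7.2.17).
[cite: CercignaniIllnerPulvirenti1994, §7.2 (2.17)] -/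
def gradRadial (β : ℝ) (u : EuclideanSpace ℝ d) : ℝ :=
  (Real.sqrt (2 * Real.pi * β⁻¹))⁻¹ * (‖u‖ ^ (Fintype.card d - 2))⁻¹ *
    Real.exp (-(β / 8) * ‖u‖ ^ 2)

/-- `G_β ≥ 0`. [folklore] -/
theorem gradRadial_nonneg (β : ℝ) (u : EuclideanSpace ℝ d) : 0 ≤ gradRadial β u :=
  mul_nonneg (mul_nonneg (inv_nonneg.2 (Real.sqrt_nonneg _))
    (inv_nonneg.2 (pow_nonneg (norm_nonneg _) _))) (Real.exp_nonneg _)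

/-- `G_β` is even. [folklore] -/
theorem gradRadial_neg (β : ℝ) (u : EuclideanSpace ℝ d) : gradRadial β (-u) = gradRadial β u := by
  simp [gradRadial, norm_neg]

/-- `G_β` is measurable. [folklore] -/
@[fun_prop]
theorem measurable_gradRadial (β : ℝ) : Measurable (gradRadial (d := d) β) := by
  unfold gradRadial
  fun_prop

/-- `G_β` only depends on `|u|`: `G_β(u) = G⁰_β(|u|)` with
`G⁰_β(y) = (2π/β)^{-1/2} (y^{d-2})⁻¹ e^{-βy²/8}`. [folklore] -/
theorem gradRadial_eq_comp_norm (β : ℝ) :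
    gradRadial (d := d) β = fun u => (fun y : ℝ => (Real.sqrt (2 * Real.pi * β⁻¹))⁻¹ *
      (y ^ (Fintype.card d - 2))⁻¹ * Real.exp (-(β / 8) * y ^ 2)) ‖u‖ := rfl

/-- **`G_β` is integrable on `ℝ^d`** (`d ≥ 2`, `β > 0`): in polar coordinates the integrand is
`c y e^{-βy²/8}` on `(0, ∞)`. [folklore] -/
theorem integrable_gradRadial (hd : 2 ≤ Fintype.card d) (hβ : 0 < β) :
    Integrable (gradRadial (d := d) β) := by
  haveI : Nonempty d := Fintype.card_pos_iff.1 (by omega)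
  rw [gradRadial_eq_comp_norm]
  refine (integrable_fun_norm_addHaar (volume : Measure (EuclideanSpace ℝ d))
    (f := fun y : ℝ => (Real.sqrt (2 * Real.pi * β⁻¹))⁻¹ * (y ^ (Fintype.card d - 2))⁻¹ *
      Real.exp (-(β / 8) * y ^ 2))).2 ?_
  rw [finrank_euclideanSpace]
  have hb : 0 < β / 8 := by positivity
  have hint : IntegrableOn (fun y : ℝ => (Real.sqrt (2 * Real.pi * β⁻¹))⁻¹ *
      (y * Real.exp (-(β / 8) * y ^ 2))) (Ioi 0) :=
    ((integrable_mul_exp_neg_mul_sq hb).const_mul _).integrableOn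
  refine hint.congr_fun (fun y hy => ?_) measurableSet_Ioi
  have hy' : (0 : ℝ) < y := hy
  simp only [smul_eq_mul]
  obtain ⟨k, hk⟩ := Nat.exists_eq_add_of_le hd
  rw [hk, show 2 + k - 1 = k + 1 by omega, show 2 + k - 2 = k by omega, pow_succ]
  field_simp
  ring

/-- The integral `I_β = ∫ G_β(u) du` is nonnegative. [folklore] -/
theorem integral_gradRadial_nonneg (β : ℝ) : 0 ≤ ∫ u : EuclideanSpace ℝ d, gradRadial β u :=
  integral_nonneg (gradRadial_nonneg β)

/-- **`∫_{|u| < δ} G_β(u) du → 0` as `δ = (n+1)⁻¹ → 0`** (the balls decrease to the null set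
`{0}`). [folklore] -/
theorem tendsto_setIntegral_gradRadial (hd : 2 ≤ Fintype.card d) (hβ : 0 < β) :
    Tendsto (fun n : ℕ => ∫ u in ball (0 : EuclideanSpace ℝ d) (((n : ℝ) + 1)⁻¹), gradRadial β u)
      atTop (𝓝 0) := by
  haveI : Nonempty d := Fintype.card_pos_iff.1 (by omega)
  have hanti : Antitone fun n : ℕ => ball (0 : EuclideanSpace ℝ d) (((n : ℝ) + 1)⁻¹) := by
    intro m n hmn
    refine ball_subset_ball ?_
    gcongr
  have h := tendsto_setIntegral_of_antitone (μ := (volume : Measure (EuclideanSpace ℝ d)))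
    (f := gradRadial β) (fun n => measurableSet_ball) hanti
    ⟨0, (integrable_gradRadial hd hβ).integrableOn⟩
  have hinter : (⋂ n : ℕ, ball (0 : EuclideanSpace ℝ d) (((n : ℝ) + 1)⁻¹)) = {0} := by
    ext u
    simp only [mem_iInter, mem_ball, dist_zero_right, mem_singleton_iff]
    constructor
    · intro hu
      by_contra hne
      have hpos : 0 < ‖u‖ := norm_pos_iff.2 hne
      obtain ⟨n, hn⟩ := exists_nat_gt (‖u‖⁻¹)
      have h1 := hu n
      have h2 : ((n : ℝ) + 1)⁻¹ < ‖u‖ := by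
        rw [inv_lt_comm₀ (by positivity) hpos]
        linarith
      linarith
    · intro hu n
      rw [hu, norm_zero]
      positivity
  have h0 : (volume : Measure (EuclideanSpace ℝ d)) {0} = 0 := measure_singleton 0
  rw [hinter, Measure.restrict_singleton, integral_smul_measure, h0] at h
  simpa using h

/-! ## The key pointwise inequality -/

/-- **Grad's bound in the weighted form used by the Schur test**:
`M_β(v) k_β(v, u) · √(a_β M_β(v)) / √(a_β M_β(v + u)) ≤ (a_β M_β)(v) · G_β(u) / √(a_β(v) a_β(v + u))`.
[folklore] -/
theorem maxwellianBeta_mul_carlemanKernel_mul_weight_le (hd : 2 ≤ Fintype.card d) (hβ : 0 < β)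
    (v u : EuclideanSpace ℝ d) :
    maxwellianBeta β v * carlemanKernel β v u *
        (Real.sqrt (collisionFrequency β v * maxwellianBeta β v) /
          Real.sqrt (collisionFrequency β (v + u) * maxwellianBeta β (v + u))) ≤
      collisionFrequency β v * maxwellianBeta β v *
        (gradRadial β u / Real.sqrt (collisionFrequency β v * collisionFrequency β (v + u))) := by
  obtain ⟨a₀, ha₀, c, hc, hlow⟩ := exists_collisionFrequency_lowerBound (d := d) hd hβ
  have ha : ∀ w : EuclideanSpace ℝ d, 0 < collisionFrequency β w := fun w => ha₀.trans_le (hlow w).1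
  have hM : ∀ w : EuclideanSpace ℝ d, 0 < maxwellianBeta β w := fun w => maxwellianBeta_pos hβ w
  set a := collisionFrequency β v with ha_def
  set a' := collisionFrequency β (v + u) with ha'_def
  set M := maxwellianBeta β v with hM_def
  set M' := maxwellianBeta β (v + u) with hM'_def
  have hav : 0 < a := ha v
  have hav' : 0 < a' := ha (v + u)
  have hMv : 0 < M := hM v
  have hMv' : 0 < M' := hM (v + u)
  have hgrad : M * carlemanKernel β v u ≤ gradRadial β u * Real.sqrt (M * M') := by
    have h := maxwellianBeta_mul_carlemanKernel_le hβ v u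
    simpa [gradRadial, hM_def, hM'_def, mul_assoc, mul_comm, mul_left_comm] using h
  have hsq : Real.sqrt (a * M) / Real.sqrt (a' * M') = Real.sqrt a * Real.sqrt M /
      (Real.sqrt a' * Real.sqrt M') := by
    rw [Real.sqrt_mul hav.le, Real.sqrt_mul hav'.le]
  have hsqMM : Real.sqrt (M * M') = Real.sqrt M * Real.sqrt M' := Real.sqrt_mul hMv.le _
  have hsqaa : Real.sqrt (a * a') = Real.sqrt a * Real.sqrt a' := Real.sqrt_mul hav.le _
  have hw : 0 ≤ Real.sqrt (a * M) / Real.sqrt (a' * M') := by positivity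
  calc M * carlemanKernel β v u * (Real.sqrt (a * M) / Real.sqrt (a' * M'))
      ≤ gradRadial β u * Real.sqrt (M * M') * (Real.sqrt (a * M) / Real.sqrt (a' * M')) :=
        mul_le_mul_of_nonneg_right hgrad hw
    _ = a * M * (gradRadial β u / Real.sqrt (a * a')) := by
        rw [hsq, hsqMM, hsqaa]
        have key : ∀ x y x' y' G : ℝ, 0 < x → 0 < y → 0 < x' → 0 < y' →
            G * (y * y') * (x * y / (x' * y')) = x ^ 2 * y ^ 2 * (G / (x * x')) := by
          intro x y x' y' G hx hy hx' hy'
          field_simp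
        have h := key (Real.sqrt a) (Real.sqrt M) (Real.sqrt a') (Real.sqrt M') (gradRadial β u)
          (Real.sqrt_pos.2 hav) (Real.sqrt_pos.2 hMv) (Real.sqrt_pos.2 hav') (Real.sqrt_pos.2 hMv')
        rwa [Real.sq_sqrt hav.le, Real.sq_sqrt hMv.le] at h

/-! ## Functions of finite energy, cut-offs, the Schur weight -/

/-- `g` has finite `a_β M_β`-energy: it is measurable with `∫ g² a_β M_β dv < ∞`, i.e. it is a
(measurable representative of an) element of BGSR's Hilbert space `L²(ℝ^d, a_β M_β dv)` of
Lemma 6.1. [cite: BodineauGallagherSaintRaymondInvent2016, Lemma 6.1] -/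
structure FiniteEnergy (β : ℝ) (g : EuclideanSpace ℝ d → ℝ) : Prop where
  /-- measurability -/
  measurable : Measurable g
  /-- the energy integral converges -/
  integrable : Integrable fun v => g v ^ 2 * collisionFrequency β v * maxwellianBeta β v

/-- A *cut-off* on `ℝ^d × ℝ^d`: measurable with values in `[0, 1]`. [folklore] -/
structure IsCutoff (χ : EuclideanSpace ℝ d × EuclideanSpace ℝ d → ℝ) : Prop where
  /-- measurability -/
  measurable : Measurable χ
  /-- nonnegativity -/
  nonneg : ∀ z, 0 ≤ χ z
  /-- bounded by one -/
  le_one : ∀ z, χ z ≤ 1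

/-- The reflected cut-off `χ~(v, u) = χ(v + u, -u)` (the cut-off seen from `v' = v + u`).
[folklore] -/
def reflectCutoff (χ : EuclideanSpace ℝ d × EuclideanSpace ℝ d → ℝ) :
    EuclideanSpace ℝ d × EuclideanSpace ℝ d → ℝ :=
  fun z => χ (z.1 + z.2, -z.2)

omit [Fintype d] in
/-- Unfolding `reflectCutoff`. [folklore] -/
@[simp]
theorem reflectCutoff_apply (χ : EuclideanSpace ℝ d × EuclideanSpace ℝ d → ℝ)
    (z : EuclideanSpace ℝ d × EuclideanSpace ℝ d) : reflectCutoff χ z = χ (z.1 + z.2, -z.2) := rfl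

/-- The reflection of a cut-off is a cut-off. [folklore] -/
theorem IsCutoff.reflect {χ : EuclideanSpace ℝ d × EuclideanSpace ℝ d → ℝ} (hχ : IsCutoff χ) :
    IsCutoff (reflectCutoff χ) where
  measurable := hχ.measurable.comp ((measurable_fst.add measurable_snd).prodMk measurable_snd.neg)
  nonneg _ := hχ.nonneg _
  le_one _ := hχ.le_one _

omit [Fintype d] in
/-- The constant cut-off `1`. [folklore] -/
theorem isCutoff_one : IsCutoff (fun _ : EuclideanSpace ℝ d × EuclideanSpace ℝ d => (1 : ℝ)) where
  measurable := measurable_const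
  nonneg _ := zero_le_one
  le_one _ := le_rfl

/-- The *row integrals are bounded by `ρ`*: for every `v`,
`∫ χ(v, u) G_β(u) / √(a_β(v) a_β(v + u)) du ≤ ρ` (as a `lintegral`). This is the quantity
controlling the operator norm of the truncated gain operator in the weighted Schur test
(`sq_truncForm_le`). [folklore] -/
def RowBound (β : ℝ) (χ : EuclideanSpace ℝ d × EuclideanSpace ℝ d → ℝ) (ρ : ℝ) : Prop :=
  ∀ v : EuclideanSpace ℝ d, ∫⁻ u, ENNReal.ofReal (χ (v, u) *
    (gradRadial β u / Real.sqrt (collisionFrequency β v * collisionFrequency β (v + u)))) ≤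
      ENNReal.ofReal ρ

/-- Row bounds are monotone in the cut-off. [folklore] -/
theorem RowBound.mono {χ χ' : EuclideanSpace ℝ d × EuclideanSpace ℝ d → ℝ} {ρ : ℝ}
    (h : RowBound β χ' ρ) (hle : ∀ z, χ z ≤ χ' z) : RowBound β χ ρ := by
  intro v
  refine (lintegral_mono fun u => ENNReal.ofReal_le_ofReal ?_).trans (h v)
  refine mul_le_mul_of_nonneg_right (hle _) (div_nonneg (gradRadial_nonneg β u)
    (Real.sqrt_nonneg _))

/-- The Schur weight `w(v, u) = √(a_β M_β(v)) / √(a_β M_β(v + u))`. [folklore] -/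
def schurWeight (β : ℝ) (z : EuclideanSpace ℝ d × EuclideanSpace ℝ d) : ℝ :=
  Real.sqrt (collisionFrequency β z.1 * maxwellianBeta β z.1) /
    Real.sqrt (collisionFrequency β (z.1 + z.2) * maxwellianBeta β (z.1 + z.2))

/-- `a_β M_β > 0` (for `d ≥ 2`, `β > 0`). [folklore] -/
theorem collisionFrequency_mul_maxwellianBeta_pos (hd : 2 ≤ Fintype.card d) (hβ : 0 < β)
    (v : EuclideanSpace ℝ d) : 0 < collisionFrequency β v * maxwellianBeta β v := by
  obtain ⟨a₀, ha₀, c, hc, hlow⟩ := exists_collisionFrequency_lowerBound (d := d) hd hβ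
  exact mul_pos (ha₀.trans_le (hlow v).1) (maxwellianBeta_pos hβ v)

/-- The Schur weight is positive. [folklore] -/
theorem schurWeight_pos (hd : 2 ≤ Fintype.card d) (hβ : 0 < β)
    (z : EuclideanSpace ℝ d × EuclideanSpace ℝ d) : 0 < schurWeight β z :=
  div_pos (Real.sqrt_pos.2 (collisionFrequency_mul_maxwellianBeta_pos hd hβ _))
    (Real.sqrt_pos.2 (collisionFrequency_mul_maxwellianBeta_pos hd hβ _))

/-- Measurability of `a_β M_β`. [folklore] -/
@[fun_prop]
theorem measurable_collisionFrequency_mul_maxwellianBeta (hβ : 0 < β) :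
    Measurable fun v : EuclideanSpace ℝ d => collisionFrequency β v * maxwellianBeta β v :=
  ((continuous_collisionFrequency hβ).mul (KineticTheory.continuous_maxwellianBeta β)).measurable

/-- The Schur weight is measurable. [folklore] -/
@[fun_prop]
theorem measurable_schurWeight (hβ : 0 < β) : Measurable (schurWeight (d := d) β) := by
  unfold schurWeight
  have h := measurable_collisionFrequency_mul_maxwellianBeta (d := d) hβ
  exact ((h.comp measurable_fst).sqrt).div ((h.comp (measurable_fst.add measurable_snd)).sqrt)

/-- Under `(v, u) ↦ (v + u, -u)` the Schur weight is inverted. [folklore] -/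
theorem schurWeight_addNeg (β : ℝ) (z : EuclideanSpace ℝ d × EuclideanSpace ℝ d) :
    schurWeight β (z.1 + z.2, -z.2) = (schurWeight β z)⁻¹ := by
  simp [schurWeight, inv_div]

/-- Joint measurability of the Carleman kernel (curried form). [folklore] -/
@[fun_prop]
theorem measurable_carlemanKernel_prod (β : ℝ) :
    Measurable fun z : EuclideanSpace ℝ d × EuclideanSpace ℝ d => carlemanKernel β z.1 z.2 :=
  measurable_carlemanKernel β

/-! ## The truncated gain forms -/

section TruncForm

variable {χ χ₁ χ₂ : EuclideanSpace ℝ d × EuclideanSpace ℝ d → ℝ} {g g' h h' : EuclideanSpace ℝ d → ℝ}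

/-- **The truncated gain form** `Q_χ(g, h) = ∫∫ χ(v, u) M_β(v) k_β(v, u) g(v + u) h(v) du dv`
(Bochner integral on the product). For `χ = 1` this is `carlemanForm β g h = ⟨K g, h⟩_{L²(M_β)}`
(`truncForm_one`). [cite: BodineauGallagherSaintRaymondInvent2016, §6.1.2 (`L = a(v) Id - K`)] -/
def truncForm (β : ℝ) (χ : EuclideanSpace ℝ d × EuclideanSpace ℝ d → ℝ)
    (g h : EuclideanSpace ℝ d → ℝ) : ℝ :=
  ∫ z, χ z * (maxwellianBeta β z.1 * carlemanKernel β z.1 z.2 * (g (z.1 + z.2) * h z.1))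
    ∂((volume : Measure (EuclideanSpace ℝ d)).prod volume)

/-- `Q_1 = carlemanForm`. [folklore] -/
theorem truncForm_one (β : ℝ) (g h : EuclideanSpace ℝ d → ℝ) :
    truncForm β (fun _ => 1) g h = carlemanForm β g h := by
  simp [truncForm, carlemanForm]

/-- The truncated integrand is integrable (dominated by the full one,
`integrable_weight_mul_mul`). [folklore] -/
theorem integrable_truncForm_integrand (hd : 2 ≤ Fintype.card d) (hβ : 0 < β) (hχ : IsCutoff χ)
    (hg : FiniteEnergy β g) (hh : FiniteEnergy β h) :
    Integrable (fun z : EuclideanSpace ℝ d × EuclideanSpace ℝ d =>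
      χ z * (maxwellianBeta β z.1 * carlemanKernel β z.1 z.2 * (g (z.1 + z.2) * h z.1)))
      ((volume : Measure (EuclideanSpace ℝ d)).prod volume) := by
  refine (integrable_weight_mul_mul hd hβ hg.measurable hg.integrable hh.measurable
    hh.integrable).bdd_mul (c := 1) hχ.measurable.aestronglyMeasurable
    (Eventually.of_forall fun z => ?_)
  rw [Real.norm_of_nonneg (hχ.nonneg z)]
  exact hχ.le_one z

/-- Additivity of `Q_χ` in the cut-off. [folklore] -/
theorem truncForm_add_cutoff (hd : 2 ≤ Fintype.card d) (hβ : 0 < β) (hχ₁ : IsCutoff χ₁)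
    (hχ₂ : IsCutoff χ₂) (hg : FiniteEnergy β g) (hh : FiniteEnergy β h) :
    truncForm β (χ₁ + χ₂) g h = truncForm β χ₁ g h + truncForm β χ₂ g h := by
  rw [truncForm, truncForm, truncForm, ← integral_add
    (integrable_truncForm_integrand hd hβ hχ₁ hg hh)
    (integrable_truncForm_integrand hd hβ hχ₂ hg hh)]
  refine integral_congr_ae (Eventually.of_forall fun z => ?_)
  simp only [Pi.add_apply]
  ring

/-- `Q_χ` is additive in `g`. [folklore] -/
theorem truncForm_add_left (hd : 2 ≤ Fintype.card d) (hβ : 0 < β) (hχ : IsCutoff χ)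
    (hg : FiniteEnergy β g) (hg' : FiniteEnergy β g') (hh : FiniteEnergy β h) :
    truncForm β χ (g + g') h = truncForm β χ g h + truncForm β χ g' h := by
  rw [truncForm, truncForm, truncForm, ← integral_add
    (integrable_truncForm_integrand hd hβ hχ hg hh)
    (integrable_truncForm_integrand hd hβ hχ hg' hh)]
  refine integral_congr_ae (Eventually.of_forall fun z => ?_)
  simp only [Pi.add_apply]
  ring

/-- `Q_χ` is additive in `h`. [folklore] -/
theorem truncForm_add_right (hd : 2 ≤ Fintype.card d) (hβ : 0 < β) (hχ : IsCutoff χ)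
    (hg : FiniteEnergy β g) (hh : FiniteEnergy β h) (hh' : FiniteEnergy β h') :
    truncForm β χ g (h + h') = truncForm β χ g h + truncForm β χ g h' := by
  rw [truncForm, truncForm, truncForm, ← integral_add
    (integrable_truncForm_integrand hd hβ hχ hg hh)
    (integrable_truncForm_integrand hd hβ hχ hg hh')]
  refine integral_congr_ae (Eventually.of_forall fun z => ?_)
  simp only [Pi.add_apply]
  ring

/-- `Q_χ` is homogeneous in `g`. [folklore] -/
theorem truncForm_smul_left (β : ℝ) (χ : EuclideanSpace ℝ d × EuclideanSpace ℝ d → ℝ) (c : ℝ)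
    (g h : EuclideanSpace ℝ d → ℝ) : truncForm β χ (c • g) h = c * truncForm β χ g h := by
  rw [truncForm, truncForm, ← integral_const_mul]
  refine integral_congr_ae (Eventually.of_forall fun z => ?_)
  simp only [Pi.smul_apply, smul_eq_mul]
  ring

/-- `Q_χ` is homogeneous in `h`. [folklore] -/
theorem truncForm_smul_right (β : ℝ) (χ : EuclideanSpace ℝ d × EuclideanSpace ℝ d → ℝ) (c : ℝ)
    (g h : EuclideanSpace ℝ d → ℝ) : truncForm β χ g (c • h) = c * truncForm β χ g h := by
  rw [truncForm, truncForm, ← integral_const_mul]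
  refine integral_congr_ae (Eventually.of_forall fun z => ?_)
  simp only [Pi.smul_apply, smul_eq_mul]
  ring

/-- The sum map `(v, u) ↦ v + u` is quasi-measure-preserving for Lebesgue measure. [folklore] -/
theorem quasiMeasurePreserving_add_euclidean :
    Measure.QuasiMeasurePreserving (fun z : EuclideanSpace ℝ d × EuclideanSpace ℝ d => z.1 + z.2)
      ((volume : Measure (EuclideanSpace ℝ d)).prod volume) volume := by
  have h := (Measure.quasiMeasurePreserving_snd (μ := (volume : Measure (EuclideanSpace ℝ d)))
    (ν := (volume : Measure (EuclideanSpace ℝ d)))).comp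
    (measurePreserving_prod_add_euclidean (d := d)).quasiMeasurePreserving
  exact h

/-- **`Q_χ` only depends on the a.e. classes of `g` and `h`.** [folklore] -/
theorem truncForm_congr_ae (β : ℝ) (χ : EuclideanSpace ℝ d × EuclideanSpace ℝ d → ℝ)
    (hg : g =ᵐ[volume] g') (hh : h =ᵐ[volume] h') :
    truncForm β χ g h = truncForm β χ g' h' := by
  unfold truncForm
  refine integral_congr_ae ?_
  have h1 : (fun z : EuclideanSpace ℝ d × EuclideanSpace ℝ d => g (z.1 + z.2)) =ᵐ[volume.prod volume]
      fun z => g' (z.1 + z.2) := quasiMeasurePreserving_add_euclidean.ae_eq hg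
  have h2 : (fun z : EuclideanSpace ℝ d × EuclideanSpace ℝ d => h z.1) =ᵐ[volume.prod volume]
      fun z => h' z.1 := Measure.quasiMeasurePreserving_fst.ae_eq hh
  filter_upwards [h1, h2] with z hz1 hz2
  rw [hz1, hz2]

end TruncForm

/-! ## The weighted Schur test -/

section Schur

variable {χ : EuclideanSpace ℝ d × EuclideanSpace ℝ d → ℝ} {g h : EuclideanSpace ℝ d → ℝ}

/-- The energy density `h² a_β M_β` is nonnegative. [folklore] -/
theorem energy_integrand_nonneg (hβ : 0 < β) (h : EuclideanSpace ℝ d → ℝ) (v : EuclideanSpace ℝ d) :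
    0 ≤ h v ^ 2 * collisionFrequency β v * maxwellianBeta β v :=
  mul_nonneg (mul_nonneg (sq_nonneg _) (TaggedLinearBoltzmannSeries.collisionFrequency_nonneg hβ v))
    (maxwellianBeta_pos hβ v).le

/-- **The `h`-side of the Schur test**:
`∫∫ χ M_β k_β · w · h(v)² ≤ ρ ∫ h² a_β M_β` when the rows of `χ G_β / √(a a')` are `≤ ρ`.
[folklore] -/
theorem lintegral_cutoff_weight_sq_le (hd : 2 ≤ Fintype.card d) (hβ : 0 < β) (hχ : IsCutoff χ)
    {ρ : ℝ} (hrow : RowBound β χ ρ) (hh : FiniteEnergy β h) :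
    ∫⁻ z, ENNReal.ofReal (χ z * (maxwellianBeta β z.1 * carlemanKernel β z.1 z.2) *
        (schurWeight β z * h z.1 ^ 2)) ∂((volume : Measure (EuclideanSpace ℝ d)).prod volume) ≤
      ENNReal.ofReal ρ *
        ENNReal.ofReal (∫ v, h v ^ 2 * collisionFrequency β v * maxwellianBeta β v) := by
  have hχm := hχ.measurable
  have hhm := hh.measurable
  have hmeas : Measurable fun z : EuclideanSpace ℝ d × EuclideanSpace ℝ d =>
      ENNReal.ofReal (χ z * (maxwellianBeta β z.1 * carlemanKernel β z.1 z.2) *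
        (schurWeight β z * h z.1 ^ 2)) :=
    ((hχm.mul (measurable_carlemanWeight β)).mul ((measurable_schurWeight hβ).mul
      ((hhm.comp measurable_fst).pow_const 2))).ennreal_ofReal
  have hrowm : ∀ v : EuclideanSpace ℝ d, Measurable fun u : EuclideanSpace ℝ d =>
      ENNReal.ofReal (χ (v, u) * (gradRadial β u /
        Real.sqrt (collisionFrequency β v * collisionFrequency β (v + u)))) := by
    intro v
    refine ((hχm.comp measurable_prodMk_left).mul ((measurable_gradRadial β).div ?_)).ennreal_ofReal
    exact (measurable_const.mul ((continuous_collisionFrequency hβ).measurable.comp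
      (measurable_const_add v))).sqrt
  have hEm : Measurable fun v : EuclideanSpace ℝ d =>
      ENNReal.ofReal (h v ^ 2 * collisionFrequency β v * maxwellianBeta β v) :=
    (((hhm.pow_const 2).mul (continuous_collisionFrequency hβ).measurable).mul
      (KineticTheory.measurable_maxwellianBeta β)).ennreal_ofReal
  have hpt : ∀ v u : EuclideanSpace ℝ d,
      χ (v, u) * (maxwellianBeta β v * carlemanKernel β v u) * (schurWeight β (v, u) * h v ^ 2) ≤
        (h v ^ 2 * collisionFrequency β v * maxwellianBeta β v) *
          (χ (v, u) * (gradRadial β u /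
            Real.sqrt (collisionFrequency β v * collisionFrequency β (v + u)))) := by
    intro v u
    have hk := maxwellianBeta_mul_carlemanKernel_mul_weight_le hd hβ v u
    have h0 : 0 ≤ χ (v, u) * h v ^ 2 := mul_nonneg (hχ.nonneg _) (sq_nonneg _)
    calc χ (v, u) * (maxwellianBeta β v * carlemanKernel β v u) * (schurWeight β (v, u) * h v ^ 2)
        = χ (v, u) * h v ^ 2 * (maxwellianBeta β v * carlemanKernel β v u *
            (Real.sqrt (collisionFrequency β v * maxwellianBeta β v) /
              Real.sqrt (collisionFrequency β (v + u) * maxwellianBeta β (v + u)))) := by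
          simp only [schurWeight]; ring
      _ ≤ χ (v, u) * h v ^ 2 * (collisionFrequency β v * maxwellianBeta β v *
            (gradRadial β u / Real.sqrt (collisionFrequency β v * collisionFrequency β (v + u)))) :=
          mul_le_mul_of_nonneg_left hk h0
      _ = _ := by ring
  rw [lintegral_prod _ hmeas.aemeasurable]
  calc ∫⁻ v, ∫⁻ u, ENNReal.ofReal (χ (v, u) * (maxwellianBeta β v * carlemanKernel β v u) *
          (schurWeight β (v, u) * h v ^ 2))
      ≤ ∫⁻ v, ∫⁻ u, ENNReal.ofReal (h v ^ 2 * collisionFrequency β v * maxwellianBeta β v) *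
          ENNReal.ofReal (χ (v, u) * (gradRadial β u /
            Real.sqrt (collisionFrequency β v * collisionFrequency β (v + u)))) := by
        refine lintegral_mono fun v => lintegral_mono fun u => ?_
        rw [← ENNReal.ofReal_mul (energy_integrand_nonneg hβ h v)]
        exact ENNReal.ofReal_le_ofReal (hpt v u)
    _ = ∫⁻ v, ENNReal.ofReal (h v ^ 2 * collisionFrequency β v * maxwellianBeta β v) *
          ∫⁻ u, ENNReal.ofReal (χ (v, u) * (gradRadial β u /
            Real.sqrt (collisionFrequency β v * collisionFrequency β (v + u)))) :=
        lintegral_congr fun v => lintegral_const_mul _ (hrowm v)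
    _ ≤ ∫⁻ v, ENNReal.ofReal (h v ^ 2 * collisionFrequency β v * maxwellianBeta β v) *
          ENNReal.ofReal ρ :=
        lintegral_mono fun v => mul_le_mul' le_rfl (hrow v)
    _ = (∫⁻ v, ENNReal.ofReal (h v ^ 2 * collisionFrequency β v * maxwellianBeta β v)) *
          ENNReal.ofReal ρ := lintegral_mul_const _ hEm
    _ = ENNReal.ofReal ρ *
          ENNReal.ofReal (∫ v, h v ^ 2 * collisionFrequency β v * maxwellianBeta β v) := by
        rw [mul_comm, ofReal_integral_eq_lintegral_ofReal hh.integrable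
          (Eventually.of_forall (energy_integrand_nonneg hβ h))]

/-- **The `g`-side is a reflected `h`-side** (change of variables `(v, u) ↦ (v + u, -u)` and
detailed balance): `∫∫ χ M_β k_β w⁻¹ g(v + u)² = ∫∫ χ~ M_β k_β w g(v)²`. [folklore] -/
theorem lintegral_cutoff_weight_inv_sq_shift (hβ : 0 < β) (hχ : Measurable χ) (hg : Measurable g) :
    ∫⁻ z, ENNReal.ofReal (χ z * (maxwellianBeta β z.1 * carlemanKernel β z.1 z.2) *
        ((schurWeight β z)⁻¹ * g (z.1 + z.2) ^ 2)) ∂((volume : Measure (EuclideanSpace ℝ d)).prod volume) =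
      ∫⁻ z, ENNReal.ofReal (reflectCutoff χ z * (maxwellianBeta β z.1 * carlemanKernel β z.1 z.2) *
        (schurWeight β z * g z.1 ^ 2)) ∂((volume : Measure (EuclideanSpace ℝ d)).prod volume) := by
  set Φ : EuclideanSpace ℝ d × EuclideanSpace ℝ d → ℝ≥0∞ := fun z =>
    ENNReal.ofReal (reflectCutoff χ z * (maxwellianBeta β z.1 * carlemanKernel β z.1 z.2) *
      (schurWeight β z * g z.1 ^ 2)) with hΦ
  have hΦm : Measurable Φ :=
    (((hχ.comp ((measurable_fst.add measurable_snd).prodMk measurable_snd.neg)).mul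
      (measurable_carlemanWeight β)).mul ((measurable_schurWeight hβ).mul
      ((hg.comp measurable_fst).pow_const 2))).ennreal_ofReal
  have hpt : ∀ z : EuclideanSpace ℝ d × EuclideanSpace ℝ d,
      ENNReal.ofReal (χ z * (maxwellianBeta β z.1 * carlemanKernel β z.1 z.2) *
        ((schurWeight β z)⁻¹ * g (z.1 + z.2) ^ 2)) = Φ (z.1 + z.2, -z.2) := by
    intro z
    simp only [hΦ, reflectCutoff_apply, add_neg_cancel_right, neg_neg,
      ← maxwellianBeta_mul_carlemanKernel_symm hβ z.1 z.2]
    congr 2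
    have hw := schurWeight_addNeg β z
    rw [hw]
  simp_rw [hpt]
  exact measurePreserving_addNeg.lintegral_comp hΦm

/-- Integrability and size of the `h`-side weighted square. [folklore] -/
theorem integrable_cutoff_weight_sq (hd : 2 ≤ Fintype.card d) (hβ : 0 < β) (hχ : IsCutoff χ)
    {ρ : ℝ} (hρ : 0 ≤ ρ) (hrow : RowBound β χ ρ) (hh : FiniteEnergy β h) :
    Integrable (fun z : EuclideanSpace ℝ d × EuclideanSpace ℝ d =>
        χ z * (maxwellianBeta β z.1 * carlemanKernel β z.1 z.2) * (schurWeight β z * h z.1 ^ 2))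
      ((volume : Measure (EuclideanSpace ℝ d)).prod volume) ∧
    ∫ z, χ z * (maxwellianBeta β z.1 * carlemanKernel β z.1 z.2) * (schurWeight β z * h z.1 ^ 2)
        ∂((volume : Measure (EuclideanSpace ℝ d)).prod volume) ≤
      ρ * ∫ v, h v ^ 2 * collisionFrequency β v * maxwellianBeta β v := by
  have hnn : ∀ z : EuclideanSpace ℝ d × EuclideanSpace ℝ d,
      0 ≤ χ z * (maxwellianBeta β z.1 * carlemanKernel β z.1 z.2) * (schurWeight β z * h z.1 ^ 2) :=
    fun z => mul_nonneg (mul_nonneg (hχ.nonneg z) (carlemanWeight_nonneg hβ z))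
      (mul_nonneg (schurWeight_pos hd hβ z).le (sq_nonneg _))
  have hmeas : Measurable fun z : EuclideanSpace ℝ d × EuclideanSpace ℝ d =>
      χ z * (maxwellianBeta β z.1 * carlemanKernel β z.1 z.2) * (schurWeight β z * h z.1 ^ 2) :=
    (hχ.measurable.mul (measurable_carlemanWeight β)).mul ((measurable_schurWeight hβ).mul
      ((hh.measurable.comp measurable_fst).pow_const 2))
  have hbound := lintegral_cutoff_weight_sq_le hd hβ hχ hrow hh
  have hlt : ∫⁻ z, ENNReal.ofReal (χ z * (maxwellianBeta β z.1 * carlemanKernel β z.1 z.2) *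
      (schurWeight β z * h z.1 ^ 2)) ∂((volume : Measure (EuclideanSpace ℝ d)).prod volume) < ∞ :=
    lt_of_le_of_lt hbound (ENNReal.mul_lt_top ENNReal.ofReal_lt_top ENNReal.ofReal_lt_top)
  have hint : Integrable (fun z : EuclideanSpace ℝ d × EuclideanSpace ℝ d =>
      χ z * (maxwellianBeta β z.1 * carlemanKernel β z.1 z.2) * (schurWeight β z * h z.1 ^ 2))
      ((volume : Measure (EuclideanSpace ℝ d)).prod volume) := by
    refine ⟨hmeas.aestronglyMeasurable, ?_⟩
    refine lt_of_le_of_lt (le_of_eq (lintegral_congr fun z => ?_)) hlt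
    rw [Real.enorm_of_nonneg (hnn z)]
  refine ⟨hint, ?_⟩
  rw [integral_eq_lintegral_of_nonneg_ae (Eventually.of_forall hnn) hmeas.aestronglyMeasurable]
  have hE : 0 ≤ ∫ v, h v ^ 2 * collisionFrequency β v * maxwellianBeta β v :=
    integral_nonneg (energy_integrand_nonneg hβ h)
  calc (∫⁻ z, ENNReal.ofReal (χ z * (maxwellianBeta β z.1 * carlemanKernel β z.1 z.2) *
        (schurWeight β z * h z.1 ^ 2)) ∂((volume : Measure (EuclideanSpace ℝ d)).prod volume)).toReal
      ≤ (ENNReal.ofReal ρ * ENNReal.ofReal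
          (∫ v, h v ^ 2 * collisionFrequency β v * maxwellianBeta β v)).toReal :=
        ENNReal.toReal_mono (ENNReal.mul_ne_top ENNReal.ofReal_ne_top ENNReal.ofReal_ne_top) hbound
    _ = ρ * ∫ v, h v ^ 2 * collisionFrequency β v * maxwellianBeta β v := by
        rw [ENNReal.toReal_mul, ENNReal.toReal_ofReal hρ, ENNReal.toReal_ofReal hE]

/-- Integrability and size of the `g`-side weighted square. [folklore] -/
theorem integrable_cutoff_weight_inv_sq (hd : 2 ≤ Fintype.card d) (hβ : 0 < β) (hχ : IsCutoff χ)
    {ρ' : ℝ} (hρ' : 0 ≤ ρ') (hrow' : RowBound β (reflectCutoff χ) ρ') (hg : FiniteEnergy β g) :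
    Integrable (fun z : EuclideanSpace ℝ d × EuclideanSpace ℝ d =>
        χ z * (maxwellianBeta β z.1 * carlemanKernel β z.1 z.2) *
          ((schurWeight β z)⁻¹ * g (z.1 + z.2) ^ 2))
      ((volume : Measure (EuclideanSpace ℝ d)).prod volume) ∧
    ∫ z, χ z * (maxwellianBeta β z.1 * carlemanKernel β z.1 z.2) *
        ((schurWeight β z)⁻¹ * g (z.1 + z.2) ^ 2) ∂((volume : Measure (EuclideanSpace ℝ d)).prod volume) ≤
      ρ' * ∫ v, g v ^ 2 * collisionFrequency β v * maxwellianBeta β v := by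
  have hnn : ∀ z : EuclideanSpace ℝ d × EuclideanSpace ℝ d,
      0 ≤ χ z * (maxwellianBeta β z.1 * carlemanKernel β z.1 z.2) *
        ((schurWeight β z)⁻¹ * g (z.1 + z.2) ^ 2) :=
    fun z => mul_nonneg (mul_nonneg (hχ.nonneg z) (carlemanWeight_nonneg hβ z))
      (mul_nonneg (inv_nonneg.2 (schurWeight_pos hd hβ z).le) (sq_nonneg _))
  have hmeas : Measurable fun z : EuclideanSpace ℝ d × EuclideanSpace ℝ d =>
      χ z * (maxwellianBeta β z.1 * carlemanKernel β z.1 z.2) *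
        ((schurWeight β z)⁻¹ * g (z.1 + z.2) ^ 2) :=
    (hχ.measurable.mul (measurable_carlemanWeight β)).mul ((measurable_schurWeight hβ).inv.mul
      ((hg.measurable.comp (measurable_fst.add measurable_snd)).pow_const 2))
  have hbound : ∫⁻ z, ENNReal.ofReal (χ z * (maxwellianBeta β z.1 * carlemanKernel β z.1 z.2) *
      ((schurWeight β z)⁻¹ * g (z.1 + z.2) ^ 2)) ∂((volume : Measure (EuclideanSpace ℝ d)).prod volume) ≤
      ENNReal.ofReal ρ' *
        ENNReal.ofReal (∫ v, g v ^ 2 * collisionFrequency β v * maxwellianBeta β v) := by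
    rw [lintegral_cutoff_weight_inv_sq_shift hβ hχ.measurable hg.measurable]
    exact lintegral_cutoff_weight_sq_le hd hβ hχ.reflect hrow' hg
  have hlt : ∫⁻ z, ENNReal.ofReal (χ z * (maxwellianBeta β z.1 * carlemanKernel β z.1 z.2) *
      ((schurWeight β z)⁻¹ * g (z.1 + z.2) ^ 2)) ∂((volume : Measure (EuclideanSpace ℝ d)).prod volume)
        < ∞ :=
    lt_of_le_of_lt hbound (ENNReal.mul_lt_top ENNReal.ofReal_lt_top ENNReal.ofReal_lt_top)
  have hint : Integrable (fun z : EuclideanSpace ℝ d × EuclideanSpace ℝ d =>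
      χ z * (maxwellianBeta β z.1 * carlemanKernel β z.1 z.2) *
        ((schurWeight β z)⁻¹ * g (z.1 + z.2) ^ 2))
      ((volume : Measure (EuclideanSpace ℝ d)).prod volume) := by
    refine ⟨hmeas.aestronglyMeasurable, ?_⟩
    refine lt_of_le_of_lt (le_of_eq (lintegral_congr fun z => ?_)) hlt
    rw [Real.enorm_of_nonneg (hnn z)]
  refine ⟨hint, ?_⟩
  rw [integral_eq_lintegral_of_nonneg_ae (Eventually.of_forall hnn) hmeas.aestronglyMeasurable]
  have hE : 0 ≤ ∫ v, g v ^ 2 * collisionFrequency β v * maxwellianBeta β v :=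
    integral_nonneg (energy_integrand_nonneg hβ g)
  calc (∫⁻ z, ENNReal.ofReal (χ z * (maxwellianBeta β z.1 * carlemanKernel β z.1 z.2) *
        ((schurWeight β z)⁻¹ * g (z.1 + z.2) ^ 2))
          ∂((volume : Measure (EuclideanSpace ℝ d)).prod volume)).toReal
      ≤ (ENNReal.ofReal ρ' * ENNReal.ofReal
          (∫ v, g v ^ 2 * collisionFrequency β v * maxwellianBeta β v)).toReal :=
        ENNReal.toReal_mono (ENNReal.mul_ne_top ENNReal.ofReal_ne_top ENNReal.ofReal_ne_top) hbound
    _ = ρ' * ∫ v, g v ^ 2 * collisionFrequency β v * maxwellianBeta β v := by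
        rw [ENNReal.toReal_mul, ENNReal.toReal_ofReal hρ', ENNReal.toReal_ofReal hE]

/-- **The weighted Schur test for the truncated gain forms** (the operator-norm estimate behind
the compactness of `K` on `L²(a_β M_β)`): if the rows of `χ G_β / √(a a')` are `≤ ρ` and those
of the reflected cut-off are `≤ ρ'`, then
`Q_χ(g, h)² ≤ (ρ' ∫ g² a_β M_β) (ρ ∫ h² a_β M_β)`. Cauchy–Schwarz with the weight
`√(a_β M_β(v + u) / a_β M_β(v))`, Tonelli and Grad's bound (the Schur test; cf. the boundedness
half of CIP Thm 7.2.4, `K ∈ B(L²)`, for the linearized operator). [folklore] -/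
theorem sq_truncForm_le (hd : 2 ≤ Fintype.card d) (hβ : 0 < β) (hχ : IsCutoff χ) {ρ ρ' : ℝ}
    (hρ : 0 ≤ ρ) (hρ' : 0 ≤ ρ') (hrow : RowBound β χ ρ) (hrow' : RowBound β (reflectCutoff χ) ρ')
    (hg : FiniteEnergy β g) (hh : FiniteEnergy β h) :
    truncForm β χ g h ^ 2 ≤
      (ρ' * ∫ v, g v ^ 2 * collisionFrequency β v * maxwellianBeta β v) *
        (ρ * ∫ v, h v ^ 2 * collisionFrequency β v * maxwellianBeta β v) := by
  set W : EuclideanSpace ℝ d × EuclideanSpace ℝ d → ℝ := fun z =>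
    χ z * (maxwellianBeta β z.1 * carlemanKernel β z.1 z.2) with hW
  set U : EuclideanSpace ℝ d × EuclideanSpace ℝ d → ℝ := fun z =>
    Real.sqrt ((schurWeight β z)⁻¹) * g (z.1 + z.2) with hU
  set V : EuclideanSpace ℝ d × EuclideanSpace ℝ d → ℝ := fun z =>
    Real.sqrt (schurWeight β z) * h z.1 with hV
  have hWnn : ∀ z, 0 ≤ W z := fun z => mul_nonneg (hχ.nonneg z) (carlemanWeight_nonneg hβ z)
  have hs : ∀ z, 0 < schurWeight β z := schurWeight_pos hd hβ
  have hUV : ∀ z, U z * V z = g (z.1 + z.2) * h z.1 := by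
    intro z
    have h1 : Real.sqrt ((schurWeight β z)⁻¹) * Real.sqrt (schurWeight β z) = 1 := by
      rw [← Real.sqrt_mul (inv_nonneg.2 (hs z).le), inv_mul_cancel₀ (hs z).ne', Real.sqrt_one]
    calc U z * V z = (Real.sqrt ((schurWeight β z)⁻¹) * Real.sqrt (schurWeight β z)) *
        (g (z.1 + z.2) * h z.1) := by simp only [hU, hV]; ring
      _ = _ := by rw [h1, one_mul]
  have hU2 : ∀ z, U z ^ 2 = (schurWeight β z)⁻¹ * g (z.1 + z.2) ^ 2 := by
    intro z
    simp only [hU, mul_pow, Real.sq_sqrt (inv_nonneg.2 (hs z).le)]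
  have hV2 : ∀ z, V z ^ 2 = schurWeight β z * h z.1 ^ 2 := by
    intro z
    simp only [hV, mul_pow, Real.sq_sqrt (hs z).le]
  obtain ⟨hA, hAle⟩ := integrable_cutoff_weight_inv_sq hd hβ hχ hρ' hrow' hg
  obtain ⟨hC, hCle⟩ := integrable_cutoff_weight_sq hd hβ hχ hρ hrow hh
  have hB := integrable_truncForm_integrand hd hβ hχ hg hh
  have hA' : Integrable (fun z => W z * U z ^ 2) (volume.prod volume) :=
    hA.congr (Eventually.of_forall fun z => by simp only [hW, hU2])
  have hC' : Integrable (fun z => W z * V z ^ 2) (volume.prod volume) :=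
    hC.congr (Eventually.of_forall fun z => by simp only [hW, hV2])
  have hB' : Integrable (fun z => W z * (U z * V z)) (volume.prod volume) :=
    hB.congr (Eventually.of_forall fun z => by simp only [hW, hUV]; ring)
  have hCS := sq_integral_weight_mul_le hWnn hA' hC' hB'
  have hform : truncForm β χ g h = ∫ z, W z * (U z * V z) ∂(volume.prod volume) := by
    rw [truncForm]
    exact integral_congr_ae (Eventually.of_forall fun z => by simp only [hW, hUV]; ring)
  have hIA : ∫ z, W z * U z ^ 2 ∂(volume.prod volume) ≤
      ρ' * ∫ v, g v ^ 2 * collisionFrequency β v * maxwellianBeta β v := by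
    refine le_of_eq_of_le (integral_congr_ae (Eventually.of_forall fun z => ?_)) hAle
    simp only [hW, hU2]
  have hIC : ∫ z, W z * V z ^ 2 ∂(volume.prod volume) ≤
      ρ * ∫ v, h v ^ 2 * collisionFrequency β v * maxwellianBeta β v := by
    refine le_of_eq_of_le (integral_congr_ae (Eventually.of_forall fun z => ?_)) hCle
    simp only [hW, hV2]
  have hIA0 : 0 ≤ ∫ z, W z * U z ^ 2 ∂(volume.prod volume) :=
    integral_nonneg fun z => mul_nonneg (hWnn z) (sq_nonneg _)
  have hIC0 : 0 ≤ ∫ z, W z * V z ^ 2 ∂(volume.prod volume) :=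
    integral_nonneg fun z => mul_nonneg (hWnn z) (sq_nonneg _)
  rw [hform]
  exact hCS.trans (mul_le_mul hIA hIC hIC0 (hIA0.trans hIA))

end Schur

/-! ## Row bounds for the cut-offs of the compactness proof -/

section RowBounds

variable {χ : EuclideanSpace ℝ d × EuclideanSpace ℝ d → ℝ} {a₀ c : ℝ}

/-- `G_β(u) / √(a_β(v) a_β(v + u)) ≤ G_β(u) / a₀` when `a_β ≥ a₀ > 0`. [folklore] -/
theorem gradRadial_div_sqrt_le (hβ : 0 < β) (ha₀ : 0 < a₀) (hlow : ∀ w : EuclideanSpace ℝ d, a₀ ≤ collisionFrequency β w)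
    (v u : EuclideanSpace ℝ d) :
    gradRadial β u / Real.sqrt (collisionFrequency β v * collisionFrequency β (v + u)) ≤
      gradRadial β u / a₀ := by
  refine div_le_div_of_nonneg_left (gradRadial_nonneg β u) ha₀ ?_
  calc a₀ = Real.sqrt (a₀ * a₀) := (Real.sqrt_mul_self ha₀.le).symm
    _ ≤ Real.sqrt (collisionFrequency β v * collisionFrequency β (v + u)) :=
        Real.sqrt_le_sqrt (mul_le_mul (hlow v) (hlow (v + u)) ha₀.le
          (TaggedLinearBoltzmannSeries.collisionFrequency_nonneg hβ v))

/-- **Row bound for cut-offs `χ ≤ 1`**: `ρ = I_β / a₀`, `I_β = ∫ G_β`. [folklore] -/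
theorem rowBound_of_le_one (hd : 2 ≤ Fintype.card d) (hβ : 0 < β) (ha₀ : 0 < a₀)
    (hlow : ∀ w : EuclideanSpace ℝ d, a₀ ≤ collisionFrequency β w) (hχ1 : ∀ z, χ z ≤ 1) :
    RowBound β χ ((∫ u : EuclideanSpace ℝ d, gradRadial β u) / a₀) := by
  intro v
  have hG := integrable_gradRadial hd hβ
  calc ∫⁻ u, ENNReal.ofReal (χ (v, u) * (gradRadial β u /
        Real.sqrt (collisionFrequency β v * collisionFrequency β (v + u))))
      ≤ ∫⁻ u, ENNReal.ofReal (gradRadial β u / a₀) := by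
        refine lintegral_mono fun u => ENNReal.ofReal_le_ofReal ?_
        calc χ (v, u) * (gradRadial β u /
              Real.sqrt (collisionFrequency β v * collisionFrequency β (v + u)))
            ≤ 1 * (gradRadial β u /
              Real.sqrt (collisionFrequency β v * collisionFrequency β (v + u))) :=
              mul_le_mul_of_nonneg_right (hχ1 _) (div_nonneg (gradRadial_nonneg β u)
                (Real.sqrt_nonneg _))
          _ ≤ gradRadial β u / a₀ := by
              rw [one_mul]; exact gradRadial_div_sqrt_le hβ ha₀ hlow v u
    _ = ENNReal.ofReal (∫ u, gradRadial β u / a₀) :=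
        (ofReal_integral_eq_lintegral_ofReal (hG.div_const a₀)
          (Eventually.of_forall fun u => div_nonneg (gradRadial_nonneg β u) ha₀.le)).symm
    _ = ENNReal.ofReal ((∫ u : EuclideanSpace ℝ d, gradRadial β u) / a₀) := by
        rw [integral_div]

/-- **Row bound for cut-offs supported in `|u| < δ`**: `ρ = a₀⁻¹ ∫_{|u|<δ} G_β`. [folklore] -/
theorem rowBound_of_le_indicator_ball (hd : 2 ≤ Fintype.card d) (hβ : 0 < β) (ha₀ : 0 < a₀)
    (hlow : ∀ w : EuclideanSpace ℝ d, a₀ ≤ collisionFrequency β w) {δ : ℝ}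
    (hχle : ∀ v u, χ (v, u) ≤ (ball (0 : EuclideanSpace ℝ d) δ).indicator (fun _ => (1 : ℝ)) u) :
    RowBound β χ ((∫ u in ball (0 : EuclideanSpace ℝ d) δ, gradRadial β u) / a₀) := by
  intro v
  have hG := (integrable_gradRadial hd hβ).integrableOn (s := ball (0 : EuclideanSpace ℝ d) δ)
  have hnn : ∀ u : EuclideanSpace ℝ d, 0 ≤ (ball (0 : EuclideanSpace ℝ d) δ).indicator
      (fun u => gradRadial β u / a₀) u := fun u =>
    Set.indicator_nonneg (fun u _ => div_nonneg (gradRadial_nonneg β u) ha₀.le) u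
  calc ∫⁻ u, ENNReal.ofReal (χ (v, u) * (gradRadial β u /
        Real.sqrt (collisionFrequency β v * collisionFrequency β (v + u))))
      ≤ ∫⁻ u, ENNReal.ofReal ((ball (0 : EuclideanSpace ℝ d) δ).indicator
          (fun u => gradRadial β u / a₀) u) := by
        refine lintegral_mono fun u => ENNReal.ofReal_le_ofReal ?_
        calc χ (v, u) * (gradRadial β u /
              Real.sqrt (collisionFrequency β v * collisionFrequency β (v + u)))
            ≤ (ball (0 : EuclideanSpace ℝ d) δ).indicator (fun _ => (1 : ℝ)) u *
                (gradRadial β u / a₀) :=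
              mul_le_mul (hχle v u) (gradRadial_div_sqrt_le hβ ha₀ hlow v u)
                (div_nonneg (gradRadial_nonneg β u) (Real.sqrt_nonneg _))
                (Set.indicator_nonneg (fun _ _ => zero_le_one) u)
          _ = (ball (0 : EuclideanSpace ℝ d) δ).indicator (fun u => gradRadial β u / a₀) u := by
              by_cases hu : u ∈ ball (0 : EuclideanSpace ℝ d) δ
              · simp [hu]
              · simp [hu]
    _ = ENNReal.ofReal (∫ u, (ball (0 : EuclideanSpace ℝ d) δ).indicator
          (fun u => gradRadial β u / a₀) u) := by
        refine (ofReal_integral_eq_lintegral_ofReal ?_ (Eventually.of_forall hnn)).symm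
        exact IntegrableOn.integrable_indicator
          (hG.div_const a₀ : IntegrableOn (fun u => gradRadial β u / a₀) (ball 0 δ) volume)
          measurableSet_ball
    _ = ENNReal.ofReal ((∫ u in ball (0 : EuclideanSpace ℝ d) δ, gradRadial β u) / a₀) := by
        rw [integral_indicator measurableSet_ball, integral_div]

/-- **Row bound for cut-offs supported in `|v| > R`**: `ρ = I_β / √(a₀ c R)`, using the growth
`a_β(v) ≥ c |v|`. [folklore] -/
theorem rowBound_of_le_indicator_norm_gt (hd : 2 ≤ Fintype.card d) (hβ : 0 < β) (ha₀ : 0 < a₀)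
    (hlow : ∀ w : EuclideanSpace ℝ d, a₀ ≤ collisionFrequency β w) (hc : 0 < c)
    (hgrow : ∀ w : EuclideanSpace ℝ d, c * ‖w‖ ≤ collisionFrequency β w) {R : ℝ} (hR : 0 < R) (hχ0 : ∀ z, 0 ≤ χ z)
    (hχle : ∀ v u, χ (v, u) ≤ if R < ‖v‖ then 1 else 0) :
    RowBound β χ ((∫ u : EuclideanSpace ℝ d, gradRadial β u) / Real.sqrt (a₀ * (c * R))) := by
  intro v
  have hG := integrable_gradRadial hd hβ
  have hden : 0 < Real.sqrt (a₀ * (c * R)) := Real.sqrt_pos.2 (by positivity)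
  by_cases hv : R < ‖v‖
  · calc ∫⁻ u, ENNReal.ofReal (χ (v, u) * (gradRadial β u /
          Real.sqrt (collisionFrequency β v * collisionFrequency β (v + u))))
        ≤ ∫⁻ u, ENNReal.ofReal (gradRadial β u / Real.sqrt (a₀ * (c * R))) := by
          refine lintegral_mono fun u => ENNReal.ofReal_le_ofReal ?_
          have h1 : χ (v, u) ≤ 1 := (hχle v u).trans (by simp [hv])
          calc χ (v, u) * (gradRadial β u /
                Real.sqrt (collisionFrequency β v * collisionFrequency β (v + u)))
              ≤ 1 * (gradRadial β u /
                Real.sqrt (collisionFrequency β v * collisionFrequency β (v + u))) :=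
                mul_le_mul_of_nonneg_right h1 (div_nonneg (gradRadial_nonneg β u)
                  (Real.sqrt_nonneg _))
            _ ≤ gradRadial β u / Real.sqrt (a₀ * (c * R)) := by
                rw [one_mul]
                refine div_le_div_of_nonneg_left (gradRadial_nonneg β u) hden ?_
                rw [mul_comm (collisionFrequency β v)]
                refine Real.sqrt_le_sqrt (mul_le_mul (hlow (v + u)) ?_ (by positivity)
                  (TaggedLinearBoltzmannSeries.collisionFrequency_nonneg hβ _))
                exact ((mul_le_mul_of_nonneg_left hv.le hc.le).trans (hgrow v))
      _ = ENNReal.ofReal (∫ u, gradRadial β u / Real.sqrt (a₀ * (c * R))) :=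
          (ofReal_integral_eq_lintegral_ofReal (hG.div_const _)
            (Eventually.of_forall fun u => div_nonneg (gradRadial_nonneg β u) hden.le)).symm
      _ = ENNReal.ofReal ((∫ u : EuclideanSpace ℝ d, gradRadial β u) / Real.sqrt (a₀ * (c * R))) := by
          rw [integral_div]
  · have h0 : ∀ u, χ (v, u) = 0 := fun u =>
      le_antisymm ((hχle v u).trans (by simp [hv])) (hχ0 _)
    simp only [h0, zero_mul, ENNReal.ofReal_zero, lintegral_const, zero_mul]
    exact bot_le

end RowBounds

/-! ## The cut-offs -/

section Cutoffs

/-- A continuous radial cut-off in `u`: `θ_δ(u) = min 1 (max 0 (2|u|/δ - 1))`, which vanishes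
for `|u| ≤ δ/2` and equals `1` for `|u| ≥ δ`. [folklore] -/
def bump (δ : ℝ) (u : EuclideanSpace ℝ d) : ℝ := min 1 (max 0 (2 * ‖u‖ / δ - 1))

/-- `0 ≤ θ_δ`. [folklore] -/
theorem bump_nonneg (δ : ℝ) (u : EuclideanSpace ℝ d) : 0 ≤ bump δ u :=
  le_min zero_le_one (le_max_left _ _)

/-- `θ_δ ≤ 1`. [folklore] -/
theorem bump_le_one (δ : ℝ) (u : EuclideanSpace ℝ d) : bump δ u ≤ 1 := min_le_left _ _

/-- `θ_δ` is even. [folklore] -/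
@[simp]
theorem bump_neg (δ : ℝ) (u : EuclideanSpace ℝ d) : bump δ (-u) = bump δ u := by
  simp [bump, norm_neg]

/-- `θ_δ` is continuous. [folklore] -/
@[fun_prop]
theorem continuous_bump (δ : ℝ) : Continuous (bump (d := d) δ) := by
  unfold bump
  fun_prop

/-- `θ_δ` is measurable. [folklore] -/
@[fun_prop]
theorem measurable_bump (δ : ℝ) : Measurable (bump (d := d) δ) := (continuous_bump δ).measurable

/-- `θ_δ(u) = 0` for `|u| ≤ δ/2` (`δ > 0`). [folklore] -/
theorem bump_eq_zero {δ : ℝ} (hδ : 0 < δ) {u : EuclideanSpace ℝ d} (hu : ‖u‖ ≤ δ / 2) :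
    bump δ u = 0 := by
  unfold bump
  have h : 2 * ‖u‖ / δ - 1 ≤ 0 := by
    rw [sub_nonpos, div_le_one hδ]
    linarith
  rw [max_eq_left h, min_eq_right zero_le_one]

/-- `θ_δ(u) = 1` for `|u| ≥ δ` (`δ > 0`). [folklore] -/
theorem bump_eq_one {δ : ℝ} (hδ : 0 < δ) {u : EuclideanSpace ℝ d} (hu : δ ≤ ‖u‖) :
    bump δ u = 1 := by
  unfold bump
  have h : 1 ≤ 2 * ‖u‖ / δ - 1 := by
    rw [le_sub_iff_add_le, le_div_iff₀ hδ]
    linarith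
  rw [min_eq_left]
  exact le_max_of_le_right h

/-- `1 - θ_δ ≤ 1_{|u| < δ}` (`δ > 0`). [folklore] -/
theorem one_sub_bump_le_indicator {δ : ℝ} (hδ : 0 < δ) (u : EuclideanSpace ℝ d) :
    1 - bump δ u ≤ (ball (0 : EuclideanSpace ℝ d) δ).indicator (fun _ => (1 : ℝ)) u := by
  by_cases hu : u ∈ ball (0 : EuclideanSpace ℝ d) δ
  · rw [indicator_of_mem hu]
    linarith [bump_nonneg δ u]
  · rw [indicator_of_notMem hu]
    rw [mem_ball_zero_iff, not_lt] at hu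
    rw [bump_eq_one hδ hu, sub_self]

/-- The ball cut-off in `v`: `1_{|v| ≤ R}`. [folklore] -/
def ballCut (R : ℝ) (v : EuclideanSpace ℝ d) : ℝ := if ‖v‖ ≤ R then 1 else 0

/-- `ballCut` is an indicator. [folklore] -/
theorem ballCut_eq_indicator (R : ℝ) :
    ballCut (d := d) R = (closedBall (0 : EuclideanSpace ℝ d) R).indicator fun _ => (1 : ℝ) := by
  funext v
  by_cases hv : ‖v‖ ≤ R
  · simp [ballCut, hv]
  · simp [ballCut, hv]

/-- `ballCut` is measurable. [folklore] -/
@[fun_prop]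
theorem measurable_ballCut (R : ℝ) : Measurable (ballCut (d := d) R) := by
  rw [ballCut_eq_indicator]
  exact measurable_const.indicator measurableSet_closedBall

/-- `0 ≤ ballCut ≤ 1`. [folklore] -/
theorem ballCut_mem (R : ℝ) (v : EuclideanSpace ℝ d) : 0 ≤ ballCut R v ∧ ballCut R v ≤ 1 := by
  unfold ballCut
  split_ifs <;> norm_num

/-- The *regular* cut-off `χ_reg(v, u) = 1_{|v| ≤ R} θ_δ(u)` (bounded `v`, `u` away from `0`).
[folklore] -/
def cutReg (δ R : ℝ) (z : EuclideanSpace ℝ d × EuclideanSpace ℝ d) : ℝ := ballCut R z.1 * bump δ z.2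

/-- The *near-diagonal* cut-off `χ_near(v, u) = 1_{|v| ≤ R} (1 - θ_δ(u))` (small `|u|`).
[folklore] -/
def cutNear (δ R : ℝ) (z : EuclideanSpace ℝ d × EuclideanSpace ℝ d) : ℝ :=
  ballCut R z.1 * (1 - bump δ z.2)

/-- The *tail* cut-off `χ_tail(v, u) = 1_{|v| > R}`. [folklore] -/
def cutTail (R : ℝ) (z : EuclideanSpace ℝ d × EuclideanSpace ℝ d) : ℝ := 1 - ballCut R z.1

/-- The three cut-offs sum to `1`. [folklore] -/
theorem cutReg_add_cutNear_add_cutTail (δ R : ℝ) (z : EuclideanSpace ℝ d × EuclideanSpace ℝ d) :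
    cutReg δ R z + cutNear δ R z + cutTail R z = 1 := by
  simp only [cutReg, cutNear, cutTail]
  ring

/-- `χ_reg` is a cut-off. [folklore] -/
theorem isCutoff_cutReg (δ R : ℝ) : IsCutoff (cutReg (d := d) δ R) where
  measurable := ((measurable_ballCut R).comp measurable_fst).mul
    ((measurable_bump δ).comp measurable_snd)
  nonneg z := mul_nonneg (ballCut_mem R z.1).1 (bump_nonneg δ z.2)
  le_one z := by
    unfold cutReg
    calc ballCut R z.1 * bump δ z.2 ≤ 1 * 1 :=
          mul_le_mul (ballCut_mem R z.1).2 (bump_le_one δ z.2) (bump_nonneg δ z.2) zero_le_one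
      _ = 1 := one_mul 1

/-- `χ_near` is a cut-off. [folklore] -/
theorem isCutoff_cutNear (δ R : ℝ) : IsCutoff (cutNear (d := d) δ R) where
  measurable := ((measurable_ballCut R).comp measurable_fst).mul
    (measurable_const.sub ((measurable_bump δ).comp measurable_snd))
  nonneg z := mul_nonneg (ballCut_mem R z.1).1 (sub_nonneg.2 (bump_le_one δ z.2))
  le_one z := by
    unfold cutNear
    calc ballCut R z.1 * (1 - bump δ z.2) ≤ 1 * 1 :=
          mul_le_mul (ballCut_mem R z.1).2 (by linarith [bump_nonneg δ z.2])
            (sub_nonneg.2 (bump_le_one δ z.2)) zero_le_one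
      _ = 1 := one_mul 1

/-- `χ_tail` is a cut-off. [folklore] -/
theorem isCutoff_cutTail (R : ℝ) : IsCutoff (cutTail (d := d) R) where
  measurable := measurable_const.sub ((measurable_ballCut R).comp measurable_fst)
  nonneg z := sub_nonneg.2 (ballCut_mem R z.1).2
  le_one z := by have := (ballCut_mem R z.1).1; unfold cutTail; linarith

/-- `χ_near ≤ 1_{|u| < δ}`. [folklore] -/
theorem cutNear_le_indicator {δ : ℝ} (hδ : 0 < δ) (R : ℝ) (v u : EuclideanSpace ℝ d) :
    cutNear δ R (v, u) ≤ (ball (0 : EuclideanSpace ℝ d) δ).indicator (fun _ => (1 : ℝ)) u := by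
  unfold cutNear
  calc ballCut R v * (1 - bump δ u) ≤ 1 * (1 - bump δ u) :=
        mul_le_mul_of_nonneg_right (ballCut_mem R v).2 (sub_nonneg.2 (bump_le_one δ u))
    _ ≤ _ := by rw [one_mul]; exact one_sub_bump_le_indicator hδ u

/-- The reflected `χ_near` is also `≤ 1_{|u| < δ}`. [folklore] -/
theorem reflectCutoff_cutNear_le_indicator {δ : ℝ} (hδ : 0 < δ) (R : ℝ) (v u : EuclideanSpace ℝ d) :
    reflectCutoff (cutNear δ R) (v, u) ≤ (ball (0 : EuclideanSpace ℝ d) δ).indicator (fun _ => (1 : ℝ)) u := by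
  rw [reflectCutoff_apply]
  have h := cutNear_le_indicator hδ R (v + u) (-u)
  have hind : (ball (0 : EuclideanSpace ℝ d) δ).indicator (fun _ => (1 : ℝ)) (-u) =
      (ball (0 : EuclideanSpace ℝ d) δ).indicator (fun _ => (1 : ℝ)) u := by
    by_cases hu : u ∈ ball (0 : EuclideanSpace ℝ d) δ
    · have hu' : -u ∈ ball (0 : EuclideanSpace ℝ d) δ := by
        rw [mem_ball_zero_iff] at hu ⊢; rwa [norm_neg]
      rw [indicator_of_mem hu, indicator_of_mem hu']
    · have hu' : -u ∉ ball (0 : EuclideanSpace ℝ d) δ := by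
        rw [mem_ball_zero_iff] at hu ⊢; rwa [norm_neg]
      rw [indicator_of_notMem hu, indicator_of_notMem hu']
  rwa [hind] at h

/-- `χ_tail = 1_{|v| > R}`. [folklore] -/
theorem cutTail_le (R : ℝ) (v u : EuclideanSpace ℝ d) :
    cutTail R (v, u) ≤ if R < ‖v‖ then 1 else 0 := by
  unfold cutTail ballCut
  by_cases hv : ‖v‖ ≤ R
  · rw [if_pos hv, if_neg (not_lt.2 hv)]
    norm_num
  · rw [if_neg hv, if_pos (not_le.1 hv)]
    norm_num

/-- The reflected `χ_tail` is `≤ 1`. [folklore] -/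
theorem reflectCutoff_cutTail_le_one (R : ℝ) (z : EuclideanSpace ℝ d × EuclideanSpace ℝ d) :
    reflectCutoff (cutTail R) z ≤ 1 :=
  (isCutoff_cutTail R).reflect.le_one z

/-- `χ_reg ≤ 1` after reflection too. [folklore] -/
theorem reflectCutoff_cutReg_le_one (δ R : ℝ) (z : EuclideanSpace ℝ d × EuclideanSpace ℝ d) :
    reflectCutoff (cutReg δ R) z ≤ 1 :=
  (isCutoff_cutReg δ R).reflect.le_one z

end Cutoffs

end Literature.MathematicalPhysics.KineticTheory
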